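import Literature.NumberTheory.Transcendental.HyperlogarithmsRegularised
import Literature.NumberTheory.Transcendental.HyperlogarithmsPowerSeries
import HarnessLib

/-!
# Hyperlogarithms on `(0,1)`, VI: regularised values at the base point

Sixth layer of the analytic road to `GenusZeroPeriodsMZV`: the calculus of REGULARISED VALUES at
`0⁺` of functions with a finite logarithmic–Laurent asymptotic expansion, and its application to the
products `a^j ρ(a) L(a)_W` (`ρ` real-analytic data with Taylor coefficients `ψ`, `L = hlogSeries σ z`
the fully regularised hyperlogarithms of `HyperlogarithmsRegularised.lean`) — the boundary terms
in the evaluation of convergent integrals of hyperlogarithmic integrands by primitives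
[Brown 2009, §5.2 (regularised values `Reg_{z=σ_i}`), Lemma 4.10-type arguments]. Everything is
PROVED; no named fact is introduced.

* `Hyperlog.IsSingular (m,n)` — the singular monomials `a^m logⁿ a` (`m < 0`, or `m = 0 < n`);
  **asymptotic uniqueness** `eq_zero_of_tendsto_singular`: a finite combination of singular
  monomials which converges as `a → 0⁺` is identically zero (divide by the dominant monomial).
* `Hyperlog.HasRegValue φ c₀` — `φ(a) = c₀ + (finite singular combination) + o(1)`; if such a `φ`
  converges, it converges to `c₀` (`HasRegValue.eq_of_tendsto`); additivity, scalars, finite sums.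
* `Hyperlog.HasTaylor ρ ψ` — Taylor expansions with remainder to every order at `0⁺`; finite
  expansions, sums, scalars, Cauchy products (`HasTaylor.mul`); the hyperlogarithms of regular words
  (`hasTaylor_hlog`, from the power series of `HyperlogarithmsPowerSeries.lean`) and the regularised
  `f₀(a)_U` (`hasTaylor_hlogReg`, coefficients `Hyperlog.regCoeff`).
* PROVED: `Reg_{a=0⁺} a^j ρ(a) logⁿ a = [n = 0, j ≤ 0] ψ_{-j}` (`hasRegValue_zpow_mul_taylor_mul_log_pow`)
  and **`Reg_{a=0⁺} a^j ρ(a) L(a)_W = [j ≤ 0] Σ_{i₁+i₂=-j} ψ_{i₁} φ_{W,i₂}`**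
  (`hasRegValue_zpow_mul_taylor_mul_hlogSeries`; `L(a)_W = Σ_{W=UV} f₀(a)_U exp(z log a)_V`).

## References

* F. C. S. Brown, *Multiple zeta values and periods of moduli spaces `𝔐̄_{0,n}`*, Ann. Sci. Éc.
  Norm. Supér. (4) 42 (2009), 371–489, §4.3 (Lemma 4.10), §5.2. doi:10.24033/asens.2099. [BrownENS2009]
-/

noncomputable section

open MeasureTheory intervalIntegral Set Filter
open scoped BigOperators Topology

namespace Literature.NumberTheory.Transcendental

namespace Hyperlog

variable {α : Type*} (σ : α → ℝ)

/-! ### Asymptotic uniqueness at a logarithmic endpoint -/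

section AsymptoticUniqueness

/-- `a ↦ a^d |log a|^e → 0` as `a → 0⁺` for an integer `d ≥ 1`. [folklore] -/
theorem tendsto_zpow_mul_abs_log_pow {d : ℤ} (hd : 1 ≤ d) (e : ℕ) :
    Tendsto (fun a : ℝ => a ^ d * |Real.log a| ^ e) (𝓝[>] 0) (𝓝 0) := by
  have h := tendsto_pow_log_mul_self 0 e
  simp only [add_zero] at h
  obtain ⟨n, hn⟩ := Int.eq_ofNat_of_zero_le (by omega : 0 ≤ d - 1)
  have hd' : d = ((n + 1 : ℕ) : ℤ) := by push_cast; omega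
  refine squeeze_zero_norm' ?_ h
  filter_upwards [Ioo_mem_nhdsGT (zero_lt_one' ℝ)] with a ha
  rw [Real.norm_eq_abs, abs_mul, abs_pow, abs_abs, abs_of_nonneg (zpow_nonneg ha.1.le _), mul_comm, hd',
    zpow_natCast, pow_succ]
  refine mul_le_mul_of_nonneg_left ?_ (by positivity)
  calc a ^ n * a ≤ 1 * a := mul_le_mul_of_nonneg_right (pow_le_one₀ ha.1.le ha.2.le) ha.1.le
    _ = a := one_mul a

/-- The *singular monomials* at `0⁺`: `a^m logⁿ a` with `m < 0`, or `m = 0` and `n ≥ 1`. [folklore] -/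
def IsSingular (p : ℤ × ℕ) : Prop := p.1 < 0 ∨ (p.1 = 0 ∧ 0 < p.2)

/-- A singular monomial is unbounded: `|a^m logⁿ a| → ∞` as `a → 0⁺`. [folklore] -/
theorem tendsto_abs_singular {p : ℤ × ℕ} (hp : IsSingular p) :
    Tendsto (fun a : ℝ => |a ^ p.1 * Real.log a ^ p.2|⁻¹) (𝓝[>] 0) (𝓝 0) := by
  rcases hp with hm | ⟨hm, hn⟩
  · -- `|a^m logⁿ a|⁻¹ = a^{-m} |log a|^{-n} ≤ a^{-m}` eventually (`|log a| ≥ 1`)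
    have h := tendsto_zpow_mul_abs_log_pow (d := -p.1) (by omega) 0
    simp only [pow_zero, mul_one] at h
    refine squeeze_zero_norm' ?_ h
    filter_upwards [Ioo_mem_nhdsGT (by positivity : (0 : ℝ) < Real.exp (-1))] with a ha
    have ha1 : a < 1 := ha.2.trans (by have h := Real.exp_lt_exp.2 (show (-1 : ℝ) < 0 by norm_num); rwa [Real.exp_zero] at h)
    have hlog : 1 ≤ |Real.log a| := by
      rw [abs_of_neg (Real.log_neg ha.1 ha1)]
      have := Real.log_lt_log ha.1 ha.2
      rw [Real.log_exp] at this; linarith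
    rw [norm_inv, Real.norm_eq_abs, abs_abs, abs_mul, abs_zpow, abs_pow, abs_of_pos ha.1, mul_inv,
      ← zpow_neg]
    refine mul_le_of_le_one_right (zpow_nonneg ha.1.le _) ?_
    rw [inv_le_one_iff₀]; right; exact one_le_pow₀ hlog
  · -- `m = 0`, `n ≥ 1`: `|logⁿ a|⁻¹ → 0`
    have hlog : Tendsto (fun a : ℝ => |Real.log a|) (𝓝[>] 0) atTop :=
      tendsto_abs_atBot_atTop.comp Real.tendsto_log_nhdsGT_zero
    have h := (tendsto_pow_atTop hn.ne').comp hlog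
    have h' := h.inv_tendsto_atTop
    refine h'.congr' (Eventually.of_forall fun a => ?_)
    simp [hm, Function.comp_def, abs_pow]

/-- Ratios of monomials beyond the dominant one tend to `0`: if `m > m₀`, or `m = m₀` and `n < n₀`,
then `a^m logⁿ a / (a^{m₀} log^{n₀} a) → 0`. [folklore] -/
theorem tendsto_monomial_div {m m₀ : ℤ} {n n₀ : ℕ} (h : m₀ < m ∨ (m = m₀ ∧ n < n₀)) :
    Tendsto (fun a : ℝ => (a ^ m * Real.log a ^ n) / (a ^ m₀ * Real.log a ^ n₀)) (𝓝[>] 0) (𝓝 0) := by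
  have hev : ∀ᶠ a in 𝓝[>] (0 : ℝ), 0 < a ∧ a < Real.exp (-1) := by
    filter_upwards [Ioo_mem_nhdsGT (by positivity : (0 : ℝ) < Real.exp (-1))] with a ha
    exact ⟨ha.1, ha.2⟩
  have hlog1 : ∀ a : ℝ, 0 < a → a < Real.exp (-1) → 1 ≤ |Real.log a| := fun a ha0 ha => by
    have ha1 : a < 1 := ha.trans (by have h := Real.exp_lt_exp.2 (show (-1 : ℝ) < 0 by norm_num); rwa [Real.exp_zero] at h)
    rw [abs_of_neg (Real.log_neg ha0 ha1)]
    have := Real.log_lt_log ha0 ha; rw [Real.log_exp] at this; linarith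
  rcases h with hm | ⟨hm, hn⟩
  · -- `a^{m-m₀} |log a|^{n} / |log a|^{n₀} ≤ a^{m-m₀} |log a|^n → 0`
    have h := tendsto_zpow_mul_abs_log_pow (d := m - m₀) (by omega) n
    refine squeeze_zero_norm' ?_ h
    filter_upwards [hev] with a ha
    have hl := hlog1 a ha.1 ha.2
    have hlne : Real.log a ≠ 0 := fun h0 => by rw [h0, abs_zero] at hl; linarith
    rw [Real.norm_eq_abs, abs_div, abs_mul, abs_mul, abs_zpow, abs_zpow, abs_pow, abs_pow, abs_of_pos ha.1,
      div_eq_mul_inv, mul_inv, zpow_sub₀ ha.1.ne', div_eq_mul_inv]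
    calc a ^ m * |Real.log a| ^ n * ((a ^ m₀)⁻¹ * (|Real.log a| ^ n₀)⁻¹)
        = a ^ m * (a ^ m₀)⁻¹ * |Real.log a| ^ n * (|Real.log a| ^ n₀)⁻¹ := by ring
      _ ≤ a ^ m * (a ^ m₀)⁻¹ * |Real.log a| ^ n * 1 := by
          refine mul_le_mul_of_nonneg_left ?_ ?_
          · rw [inv_le_one_iff₀]; right; exact one_le_pow₀ hl
          · exact mul_nonneg (mul_nonneg (zpow_nonneg ha.1.le _) (inv_nonneg.2 (zpow_nonneg ha.1.le _)))
              (pow_nonneg (abs_nonneg _) _)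
      _ = a ^ m * (a ^ m₀)⁻¹ * |Real.log a| ^ n := mul_one _
  · subst hm
    obtain ⟨k, hk⟩ : ∃ k : ℕ, n₀ = n + (k + 1) := ⟨n₀ - n - 1, by omega⟩
    have hlog : Tendsto (fun a : ℝ => |Real.log a|) (𝓝[>] 0) atTop :=
      tendsto_abs_atBot_atTop.comp Real.tendsto_log_nhdsGT_zero
    have h := ((tendsto_pow_atTop (Nat.succ_ne_zero k)).comp hlog).inv_tendsto_atTop
    refine squeeze_zero_norm' ?_ h
    filter_upwards [hev] with a ha
    have hl := hlog1 a ha.1 ha.2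
    have hlne : Real.log a ≠ 0 := fun h0 => by rw [h0, abs_zero] at hl; linarith
    have hane : a ^ m ≠ 0 := zpow_ne_zero _ ha.1.ne'
    rw [Real.norm_eq_abs, hk, pow_add, mul_div_mul_left _ _ hane, div_eq_mul_inv, mul_inv,
      ← mul_assoc, mul_inv_cancel₀ (pow_ne_zero _ hlne), one_mul, abs_inv, abs_pow]
    simp [Function.comp_def, Nat.succ_eq_add_one]

/-- **Asymptotic uniqueness**: a finite combination of singular monomials `Σ c_p a^{m_p} log^{n_p} a`
that converges as `a → 0⁺` has all coefficients `0` (and limit `0`). Proof: divide by the dominant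
monomial (least `m`, then largest `n`). [folklore] -/
theorem eq_zero_of_tendsto_singular : ∀ (S : Finset (ℤ × ℕ)) (c : ℤ × ℕ → ℝ) (ℓ : ℝ),
    (∀ p ∈ S, IsSingular p) →
    Tendsto (fun a : ℝ => ∑ p ∈ S, c p * (a ^ p.1 * Real.log a ^ p.2)) (𝓝[>] 0) (𝓝 ℓ) →
    ℓ = 0 ∧ ∀ p ∈ S, c p = 0 := by
  intro S
  induction S using Finset.strongInduction with
  | H S IH =>
    intro c ℓ hsing hlim
    by_cases hS : S = ∅
    · subst hS
      simp only [Finset.sum_empty] at hlim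
      exact ⟨(tendsto_nhds_unique hlim tendsto_const_nhds), fun p hp => absurd hp (Finset.notMem_empty p)⟩
    · -- the dominant exponent: minimal `m`, then maximal `n`
      obtain ⟨p₀, hp₀, hmin⟩ := S.exists_min_image (fun p => p.1) (Finset.nonempty_iff_ne_empty.2 hS)
      set S₀ := S.filter fun p => p.1 = p₀.1 with hS₀
      have hS₀ne : S₀.Nonempty := ⟨p₀, by simp [hS₀, hp₀]⟩
      obtain ⟨q, hq, hmax⟩ := S₀.exists_max_image (fun p => p.2) hS₀ne
      have hqS : q ∈ S := (Finset.mem_filter.mp hq).1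
      have hq1 : q.1 = p₀.1 := (Finset.mem_filter.mp hq).2
      -- every other `p ∈ S` is dominated by `q`
      have hdom : ∀ p ∈ S, p ≠ q → q.1 < p.1 ∨ (p.1 = q.1 ∧ p.2 < q.2) := by
        intro p hp hne
        have h1 : q.1 ≤ p.1 := by rw [hq1]; exact hmin p hp
        rcases lt_or_eq_of_le h1 with h | h
        · exact Or.inl h
        · right
          refine ⟨h.symm, lt_of_le_of_ne (hmax p (by simp [hS₀, hp, ← h, hq1])) fun heq => hne ?_⟩
          exact Prod.ext h.symm heq
      -- `c q = 0`: divide by the dominant monomial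
      have hcq : c q = 0 := by
        have hg := tendsto_abs_singular (hsing q hqS)
        -- `φ(a) / (a^{m_q} log^{n_q} a) → c q`, and also `→ 0`
        have h1 : Tendsto (fun a : ℝ => (∑ p ∈ S, c p * (a ^ p.1 * Real.log a ^ p.2)) /
            (a ^ q.1 * Real.log a ^ q.2)) (𝓝[>] 0) (𝓝 (c q)) := by
          have hsum : Tendsto (fun a : ℝ => ∑ p ∈ S, c p * ((a ^ p.1 * Real.log a ^ p.2) /
              (a ^ q.1 * Real.log a ^ q.2))) (𝓝[>] 0) (𝓝 (∑ p ∈ S, if p = q then c q else 0)) := by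
            refine tendsto_finsetSum _ fun p hp => ?_
            by_cases hpq : p = q
            · subst hpq
              simp only [if_true]
              refine (tendsto_const_nhds (x := c p)).congr' ?_
              filter_upwards [Ioo_mem_nhdsGT (by positivity : (0 : ℝ) < Real.exp (-1))] with a ha
              have ha1 : a < 1 := ha.2.trans (by have h := Real.exp_lt_exp.2 (show (-1 : ℝ) < 0 by norm_num); rwa [Real.exp_zero] at h)
              have hl : Real.log a ≠ 0 := (Real.log_neg ha.1 ha1).ne
              rw [div_self (mul_ne_zero (zpow_ne_zero _ ha.1.ne') (pow_ne_zero _ hl)), mul_one]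
            · rw [if_neg hpq]
              simpa using (tendsto_monomial_div (hdom p hp hpq)).const_mul (c p)
          rw [Finset.sum_ite_eq' S q, if_pos hqS] at hsum
          refine hsum.congr' (Eventually.of_forall fun a => ?_)
          show _ = (∑ p ∈ S, c p * (a ^ p.1 * Real.log a ^ p.2)) / (a ^ q.1 * Real.log a ^ q.2)
          rw [Finset.sum_div]
          refine Finset.sum_congr rfl fun p _ => ?_
          ring
        have h2 : Tendsto (fun a : ℝ => (∑ p ∈ S, c p * (a ^ p.1 * Real.log a ^ p.2)) /
            (a ^ q.1 * Real.log a ^ q.2)) (𝓝[>] 0) (𝓝 0) := by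
          rw [← mul_zero ℓ]
          have : Tendsto (fun a : ℝ => (a ^ q.1 * Real.log a ^ q.2)⁻¹) (𝓝[>] 0) (𝓝 0) :=
            squeeze_zero_norm' (Eventually.of_forall fun a => by rw [norm_inv, Real.norm_eq_abs]) hg
          simpa [div_eq_mul_inv] using hlim.mul this
        exact tendsto_nhds_unique h1 h2
      -- remove `q` and conclude by induction
      have hsub : S.erase q ⊂ S := Finset.erase_ssubset hqS
      have hlim' : Tendsto (fun a : ℝ => ∑ p ∈ S.erase q, c p * (a ^ p.1 * Real.log a ^ p.2)) (𝓝[>] 0) (𝓝 ℓ) := by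
        refine hlim.congr' (Eventually.of_forall fun a => ?_)
        rw [← Finset.add_sum_erase _ _ hqS, hcq, zero_mul, zero_add]
      obtain ⟨hℓ, hc⟩ := IH _ hsub c ℓ (fun p hp => hsing p (Finset.mem_of_mem_erase hp)) hlim'
      refine ⟨hℓ, fun p hp => ?_⟩
      by_cases hpq : p = q
      · rw [hpq]; exact hcq
      · exact hc p (Finset.mem_erase.mpr ⟨hpq, hp⟩)

/-- **Regularised value at `0⁺`**: `φ(a) = c₀ + Σ_{singular} c_p a^{m_p} log^{n_p} a + o(1)`.
[folklore] -/
def HasRegValue (φ : ℝ → ℝ) (c₀ : ℝ) : Prop :=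
  ∃ (S : Finset (ℤ × ℕ)) (c : ℤ × ℕ → ℝ), (∀ p ∈ S, IsSingular p) ∧
    Tendsto (fun a => φ a - c₀ - ∑ p ∈ S, c p * (a ^ p.1 * Real.log a ^ p.2)) (𝓝[>] 0) (𝓝 0)

/-- **If a function with a regularised value converges, it converges to the regularised value.**
[folklore] -/
theorem HasRegValue.eq_of_tendsto {φ : ℝ → ℝ} {c₀ ℓ : ℝ} (h : HasRegValue φ c₀)
    (hφ : Tendsto φ (𝓝[>] 0) (𝓝 ℓ)) : ℓ = c₀ := by
  obtain ⟨S, c, hS, ht⟩ := h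
  have h1 : Tendsto (fun a => ∑ p ∈ S, c p * (a ^ p.1 * Real.log a ^ p.2)) (𝓝[>] 0) (𝓝 (ℓ - c₀ - 0)) := by
    have := (hφ.sub_const c₀).sub ht
    refine this.congr' (Eventually.of_forall fun a => ?_)
    ring
  have := (eq_zero_of_tendsto_singular S c _ hS h1).1
  linarith

/-- Regularised values add. [folklore] -/
theorem HasRegValue.add {φ ψ : ℝ → ℝ} {c d : ℝ} (hφ : HasRegValue φ c) (hψ : HasRegValue ψ d) :
    HasRegValue (fun a => φ a + ψ a) (c + d) := by
  classical
  obtain ⟨S, cS, hS, hφ⟩ := hφ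
  obtain ⟨T, cT, hT, hψ⟩ := hψ
  refine ⟨S ∪ T, fun p => (if p ∈ S then cS p else 0) + (if p ∈ T then cT p else 0), fun p hp => ?_, ?_⟩
  · rcases Finset.mem_union.mp hp with h | h
    · exact hS p h
    · exact hT p h
  · have := hφ.add hψ
    rw [add_zero] at this
    refine this.congr' (Eventually.of_forall fun a => ?_)
    simp only [add_mul, ite_mul, zero_mul, Finset.sum_add_distrib, Finset.sum_ite_mem,
      Finset.union_inter_cancel_left, Finset.union_inter_cancel_right]
    ring

/-- Regularised values scale. [folklore] -/
theorem HasRegValue.smul {φ : ℝ → ℝ} {c : ℝ} (hφ : HasRegValue φ c) (r : ℝ) :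
    HasRegValue (fun a => r * φ a) (r * c) := by
  obtain ⟨S, cS, hS, hφ⟩ := hφ
  refine ⟨S, fun p => r * cS p, hS, ?_⟩
  have := hφ.const_mul r
  rw [mul_zero] at this
  refine this.congr' (Eventually.of_forall fun a => ?_)
  simp only [mul_assoc, ← Finset.mul_sum]
  ring

/-- Finite sums of functions with regularised values. [folklore] -/
theorem HasRegValue.sum {ι : Type*} (s : Finset ι) {φ : ι → ℝ → ℝ} {c : ι → ℝ}
    (h : ∀ i ∈ s, HasRegValue (φ i) (c i)) :
    HasRegValue (fun a => ∑ i ∈ s, φ i a) (∑ i ∈ s, c i) := by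
  classical
  induction s using Finset.induction_on with
  | empty =>
    refine ⟨∅, fun _ => 0, fun p hp => absurd hp (Finset.notMem_empty p), ?_⟩
    simp
  | insert i s hi IH =>
    have h1 := (h i (Finset.mem_insert_self i s)).add (IH fun j hj => h j (Finset.mem_insert_of_mem hj))
    simp only [Finset.sum_insert hi]
    exact h1

/-- A function tending to `c₀` has regularised value `c₀`. [folklore] -/
theorem hasRegValue_of_tendsto {φ : ℝ → ℝ} {c₀ : ℝ} (h : Tendsto φ (𝓝[>] 0) (𝓝 c₀)) :
    HasRegValue φ c₀ := by
  refine ⟨∅, fun _ => 0, fun p hp => absurd hp (Finset.notMem_empty p), ?_⟩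
  simpa using h.sub_const c₀

/-- A singular monomial has regularised value `0`. [folklore] -/
theorem hasRegValue_singular {p : ℤ × ℕ} (hp : IsSingular p) (r : ℝ) :
    HasRegValue (fun a => r * (a ^ p.1 * Real.log a ^ p.2)) 0 := by
  refine ⟨{p}, fun _ => r, fun q hq => by rwa [Finset.mem_singleton.mp hq], ?_⟩
  simp

/-- Functions eventually equal near `0⁺` have the same regularised values. [folklore] -/
theorem HasRegValue.congr {φ ψ : ℝ → ℝ} {c : ℝ} (hφ : HasRegValue φ c) (h : ∀ᶠ a in 𝓝[>] (0 : ℝ), φ a = ψ a) :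
    HasRegValue ψ c := by
  obtain ⟨S, cS, hS, ht⟩ := hφ
  refine ⟨S, cS, hS, ht.congr' ?_⟩
  filter_upwards [h] with a ha
  rw [ha]

end AsymptoticUniqueness

/-! ### Taylor expansions with remainder at `0⁺`, and regularised values of `a^j ρ(a) L(a)_W` -/

section TaylorAtZero

/-- `ρ` has the Taylor coefficients `ψ` at `0⁺` to every order:
`|ρ(a) - Σ_{i≤M} ψ_i a^i| ≤ C_M a^{M+1}` near `0⁺`. [folklore] -/
def HasTaylor (ρ : ℝ → ℝ) (ψ : ℕ → ℝ) : Prop :=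
  ∀ M : ℕ, ∃ C : ℝ, ∀ᶠ a in 𝓝[>] (0 : ℝ), |ρ a - ∑ i ∈ Finset.range (M + 1), ψ i * a ^ i| ≤ C * a ^ (M + 1)

/-- A function with an exact finite expansion has these Taylor coefficients. [folklore] -/
theorem hasTaylor_of_finite {ρ : ℝ → ℝ} {ψ : ℕ → ℝ} (K : ℕ) (hψ : ∀ i, K < i → ψ i = 0)
    (h : ∀ᶠ a in 𝓝[>] (0 : ℝ), ρ a = ∑ i ∈ Finset.range (K + 1), ψ i * a ^ i) : HasTaylor ρ ψ := by
  intro M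
  refine ⟨∑ i ∈ Finset.range (K + 1), |ψ i|, ?_⟩
  filter_upwards [h, Ioo_mem_nhdsGT (zero_lt_one' ℝ)] with a ha ha1
  rw [ha]
  by_cases hKM : K ≤ M
  · -- exact: the difference vanishes
    have : ∑ i ∈ Finset.range (M + 1), ψ i * a ^ i = ∑ i ∈ Finset.range (K + 1), ψ i * a ^ i := by
      refine (Finset.sum_subset (Finset.range_mono (by omega)) fun i hi hi' => ?_).symm
      rw [Finset.mem_range] at hi hi'
      rw [hψ i (by omega), zero_mul]
    rw [this, sub_self, abs_zero]
    exact mul_nonneg (Finset.sum_nonneg fun _ _ => abs_nonneg _) (pow_nonneg ha1.1.le _)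
  · -- `M < K`: the difference is `Σ_{M < i ≤ K} ψ_i a^i`, each `|a^i| ≤ a^{M+1}`
    push Not at hKM
    have hsplit : ∑ i ∈ Finset.range (K + 1), ψ i * a ^ i - ∑ i ∈ Finset.range (M + 1), ψ i * a ^ i =
        ∑ i ∈ Finset.range (K + 1) \ Finset.range (M + 1), ψ i * a ^ i := by
      rw [Finset.sum_sdiff_eq_sub (Finset.range_mono (by omega))]
    rw [hsplit]
    have hterm : ∀ i ∈ Finset.range (K + 1) \ Finset.range (M + 1), |ψ i * a ^ i| ≤ |ψ i| * a ^ (M + 1) := by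
      intro i hi
      rw [Finset.mem_sdiff, Finset.mem_range, Finset.mem_range] at hi
      rw [abs_mul, abs_pow, abs_of_pos ha1.1]
      exact mul_le_mul_of_nonneg_left (pow_le_pow_of_le_one ha1.1.le ha1.2.le (by omega)) (abs_nonneg _)
    calc |∑ i ∈ Finset.range (K + 1) \ Finset.range (M + 1), ψ i * a ^ i|
        ≤ ∑ i ∈ Finset.range (K + 1) \ Finset.range (M + 1), |ψ i * a ^ i| := Finset.abs_sum_le_sum_abs _ _
      _ ≤ ∑ i ∈ Finset.range (K + 1) \ Finset.range (M + 1), |ψ i| * a ^ (M + 1) := Finset.sum_le_sum hterm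
      _ ≤ ∑ i ∈ Finset.range (K + 1), |ψ i| * a ^ (M + 1) :=
          Finset.sum_le_sum_of_subset_of_nonneg Finset.sdiff_subset fun i _ _ =>
            mul_nonneg (abs_nonneg _) (pow_nonneg ha1.1.le _)
      _ = (∑ i ∈ Finset.range (K + 1), |ψ i|) * a ^ (M + 1) := (Finset.sum_mul _ _ _).symm

open Finset in
/-- Reindexing the low-degree part of a product of two truncated series by the total degree. [folklore] -/
theorem sum_filter_le_eq_sum_antidiagonal (M : ℕ) (f g : ℕ → ℝ) (a : ℝ) :
    ∑ jk ∈ (range (M + 1) ×ˢ range (M + 1)).filter (fun jk => jk.1 + jk.2 ≤ M),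
        f jk.1 * g jk.2 * a ^ (jk.1 + jk.2) =
      ∑ i ∈ range (M + 1), (∑ jk ∈ antidiagonal i, f jk.1 * g jk.2) * a ^ i := by
  simp_rw [Finset.sum_mul]
  rw [Finset.sum_sigma']
  refine Finset.sum_bij' (fun jk _ => (⟨jk.1 + jk.2, jk⟩ : Σ _ : ℕ, ℕ × ℕ)) (fun x _ => x.2) ?_ ?_ ?_ ?_ ?_
  · intro jk hjk
    rw [Finset.mem_filter, Finset.mem_product, Finset.mem_range, Finset.mem_range] at hjk
    rw [Finset.mem_sigma, Finset.mem_range, HasAntidiagonal.mem_antidiagonal]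
    dsimp only
    exact ⟨by omega, rfl⟩
  · rintro ⟨i, jk⟩ hx
    rw [Finset.mem_sigma, Finset.mem_range, HasAntidiagonal.mem_antidiagonal] at hx
    dsimp only at hx
    rw [Finset.mem_filter, Finset.mem_product, Finset.mem_range, Finset.mem_range]
    dsimp only
    exact ⟨⟨by omega, by omega⟩, by omega⟩
  · intro jk _; rfl
  · rintro ⟨i, jk⟩ hx
    rw [Finset.mem_sigma, Finset.mem_range, HasAntidiagonal.mem_antidiagonal] at hx
    dsimp only at hx ⊢
    rw [hx.2]
  · intro jk _; rfl

open Finset in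
/-- **Cauchy product of Taylor expansions with remainder.** [folklore] -/
theorem HasTaylor.mul {ρ₁ ρ₂ : ℝ → ℝ} {ψ₁ ψ₂ : ℕ → ℝ} (h₁ : HasTaylor ρ₁ ψ₁) (h₂ : HasTaylor ρ₂ ψ₂) :
    HasTaylor (fun a => ρ₁ a * ρ₂ a) (fun i => ∑ jk ∈ antidiagonal i, ψ₁ jk.1 * ψ₂ jk.2) := by
  intro M
  obtain ⟨C₁, hC₁⟩ := h₁ M
  obtain ⟨C₂, hC₂⟩ := h₂ M
  set P₁ : ℝ → ℝ := fun a => ∑ i ∈ range (M + 1), ψ₁ i * a ^ i with hP₁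
  set P₂ : ℝ → ℝ := fun a => ∑ i ∈ range (M + 1), ψ₂ i * a ^ i with hP₂
  set B₁ : ℝ := ∑ i ∈ range (M + 1), |ψ₁ i| with hB₁
  set B₂ : ℝ := ∑ i ∈ range (M + 1), |ψ₂ i| with hB₂
  have hB₁0 : 0 ≤ B₁ := Finset.sum_nonneg fun _ _ => abs_nonneg _
  have hB₂0 : 0 ≤ B₂ := Finset.sum_nonneg fun _ _ => abs_nonneg _
  refine ⟨|C₁| * (B₂ + |C₂|) + B₁ * |C₂| + B₁ * B₂, ?_⟩
  filter_upwards [hC₁, hC₂, Ioo_mem_nhdsGT (zero_lt_one' ℝ)] with a h1 h2 ha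
  have ha0 := ha.1.le
  have haM : a ^ (M + 1) ≤ 1 := pow_le_one₀ ha0 ha.2.le
  have hP₁b : |P₁ a| ≤ B₁ := by
    refine (Finset.abs_sum_le_sum_abs _ _).trans (Finset.sum_le_sum fun i _ => ?_)
    rw [abs_mul, abs_pow, abs_of_pos ha.1]
    exact mul_le_of_le_one_right (abs_nonneg _) (pow_le_one₀ ha0 ha.2.le)
  have hρ₂b : |ρ₂ a| ≤ B₂ + |C₂| := by
    have hP₂b : |P₂ a| ≤ B₂ := by
      refine (Finset.abs_sum_le_sum_abs _ _).trans (Finset.sum_le_sum fun i _ => ?_)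
      rw [abs_mul, abs_pow, abs_of_pos ha.1]
      exact mul_le_of_le_one_right (abs_nonneg _) (pow_le_one₀ ha0 ha.2.le)
    have : |ρ₂ a - P₂ a| ≤ |C₂| * 1 :=
      (h2.trans (mul_le_mul_of_nonneg_right (le_abs_self _) (pow_nonneg ha0 _))).trans
        (mul_le_mul_of_nonneg_left haM (abs_nonneg _))
    calc |ρ₂ a| = |P₂ a + (ρ₂ a - P₂ a)| := by ring_nf
      _ ≤ |P₂ a| + |ρ₂ a - P₂ a| := abs_add_le _ _
      _ ≤ B₂ + |C₂| := by linarith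
  -- the product of the truncations, split at order `M`
  set H : ℝ := ∑ jk ∈ (range (M + 1) ×ˢ range (M + 1)).filter (fun jk => ¬ jk.1 + jk.2 ≤ M),
    ψ₁ jk.1 * ψ₂ jk.2 * a ^ (jk.1 + jk.2) with hH
  have hprod : P₁ a * P₂ a =
      ∑ i ∈ range (M + 1), (∑ jk ∈ antidiagonal i, ψ₁ jk.1 * ψ₂ jk.2) * a ^ i + H := by
    rw [hP₁, hP₂, Finset.sum_mul_sum, ← Finset.sum_product', ← sum_filter_le_eq_sum_antidiagonal, hH,
      Finset.sum_filter_add_sum_filter_not]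
    refine Finset.sum_congr rfl fun jk _ => ?_
    rw [pow_add]; ring
  have hhigh : |H| ≤ B₁ * B₂ * a ^ (M + 1) := by
    rw [hH]
    refine (Finset.abs_sum_le_sum_abs _ _).trans ?_
    have hle : ∀ jk ∈ (range (M + 1) ×ˢ range (M + 1)).filter (fun jk => ¬ jk.1 + jk.2 ≤ M),
        |ψ₁ jk.1 * ψ₂ jk.2 * a ^ (jk.1 + jk.2)| ≤ |ψ₁ jk.1| * |ψ₂ jk.2| * a ^ (M + 1) := by
      intro jk hjk
      rw [Finset.mem_filter] at hjk
      rw [abs_mul, abs_mul, abs_pow, abs_of_pos ha.1]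
      exact mul_le_mul_of_nonneg_left (pow_le_pow_of_le_one ha0 ha.2.le (by omega)) (by positivity)
    refine (Finset.sum_le_sum hle).trans ?_
    rw [← Finset.sum_mul]
    refine mul_le_mul_of_nonneg_right ?_ (pow_nonneg ha0 _)
    refine (Finset.sum_le_sum_of_subset_of_nonneg (Finset.filter_subset _ _) fun _ _ _ => by positivity).trans ?_
    rw [Finset.sum_product, hB₁, hB₂, Finset.sum_mul_sum]
  have hdecomp : ρ₁ a * ρ₂ a - ∑ i ∈ range (M + 1), (∑ jk ∈ antidiagonal i, ψ₁ jk.1 * ψ₂ jk.2) * a ^ i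
      = (ρ₁ a - P₁ a) * ρ₂ a + P₁ a * (ρ₂ a - P₂ a) + H := by
    linear_combination hprod
  rw [hdecomp]
  calc |(ρ₁ a - P₁ a) * ρ₂ a + P₁ a * (ρ₂ a - P₂ a) + H|
      ≤ |(ρ₁ a - P₁ a) * ρ₂ a| + |P₁ a * (ρ₂ a - P₂ a)| + |H| :=
        (abs_add_le _ _).trans (add_le_add (abs_add_le _ _) le_rfl)
    _ ≤ |C₁| * a ^ (M + 1) * (B₂ + |C₂|) + B₁ * (|C₂| * a ^ (M + 1)) + B₁ * B₂ * a ^ (M + 1) := by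
        refine add_le_add (add_le_add ?_ ?_) hhigh
        · rw [abs_mul]
          exact mul_le_mul (h1.trans (mul_le_mul_of_nonneg_right (le_abs_self _) (pow_nonneg ha0 _)))
            hρ₂b (abs_nonneg _) (by positivity)
        · rw [abs_mul]
          exact mul_le_mul hP₁b (h2.trans (mul_le_mul_of_nonneg_right (le_abs_self _) (pow_nonneg ha0 _)))
            (abs_nonneg _) hB₁0
    _ = (|C₁| * (B₂ + |C₂|) + B₁ * |C₂| + B₁ * B₂) * a ^ (M + 1) := by ring

end TaylorAtZero

/-! ### Regularised values of `a^j ρ(a) logⁿ a` and of `a^j ρ(a) L(a)_W` -/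

section RegValues

/-- **Core computation**: if `ρ` has Taylor coefficients `ψ` at `0⁺`, then `a^j ρ(a) logⁿ(a)` has the
regularised value `ψ_{-j}` if `n = 0` and `j ≤ 0`, and `0` otherwise. [folklore] -/
theorem hasRegValue_zpow_mul_taylor_mul_log_pow {ρ : ℝ → ℝ} {ψ : ℕ → ℝ} (hρ : HasTaylor ρ ψ)
    (j : ℤ) (n : ℕ) :
    HasRegValue (fun a => a ^ j * ρ a * Real.log a ^ n) (if n = 0 ∧ j ≤ 0 then ψ (-j).toNat else 0) := by
  classical
  -- expand `ρ` to order `M` with `M + 1 + j ≥ 1`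
  set M : ℕ := (-j).toNat with hM
  have hMj : 1 ≤ (M : ℤ) + 1 + j := by rw [hM]; omega
  obtain ⟨C, hC⟩ := hρ M
  -- the monomials `ψ_i a^{i+j} logⁿ a`, `i ≤ M`
  have hmono : ∀ i ∈ Finset.range (M + 1), HasRegValue (fun a : ℝ => ψ i * (a ^ ((i : ℤ) + j) * Real.log a ^ n))
      (if n = 0 ∧ (i : ℤ) + j = 0 then ψ i else 0) := by
    intro i _
    by_cases h0 : (i : ℤ) + j = 0
    · by_cases hn : n = 0
      · simp only [hn, h0, and_self, if_true]
        refine hasRegValue_of_tendsto ((tendsto_const_nhds (x := ψ i)).congr' ?_)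
        filter_upwards [self_mem_nhdsWithin] with a (ha : 0 < a)
        simp
      · simp only [hn, false_and, if_false]
        exact hasRegValue_singular (p := ((i : ℤ) + j, n)) (Or.inr ⟨h0, Nat.pos_of_ne_zero hn⟩) (ψ i)
    · simp only [h0, and_false, if_false]
      rcases lt_or_gt_of_ne h0 with hneg | hpos
      · exact hasRegValue_singular (p := ((i : ℤ) + j, n)) (Or.inl hneg) (ψ i)
      · refine hasRegValue_of_tendsto ?_
        have h := (tendsto_zpow_mul_abs_log_pow (d := (i : ℤ) + j) (by omega) n).const_mul (|ψ i|)
        rw [mul_zero] at h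
        refine squeeze_zero_norm' ?_ h
        filter_upwards [self_mem_nhdsWithin] with a ha
        have ha0 : 0 < a := ha
        rw [Real.norm_eq_abs, abs_mul, abs_mul, abs_pow, abs_zpow, abs_of_pos ha0]
  have hsum := HasRegValue.sum (Finset.range (M + 1)) hmono
  -- the remainder `a^j (ρ - P) logⁿ a → 0`
  have hrem : HasRegValue (fun a : ℝ => a ^ j * (ρ a - ∑ i ∈ Finset.range (M + 1), ψ i * a ^ i) * Real.log a ^ n) 0 := by
    refine hasRegValue_of_tendsto ?_
    have h := (tendsto_zpow_mul_abs_log_pow (d := (M : ℤ) + 1 + j) hMj n).const_mul (|C|)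
    rw [mul_zero] at h
    refine squeeze_zero_norm' ?_ h
    filter_upwards [hC, Ioo_mem_nhdsGT (zero_lt_one' ℝ)] with a ha ha1
    rw [Real.norm_eq_abs, abs_mul, abs_mul, abs_pow, abs_zpow, abs_of_pos ha1.1]
    have hzp : a ^ ((M : ℤ) + 1 + j) = a ^ (M + 1) * a ^ j := by
      rw [zpow_add₀ ha1.1.ne', ← zpow_natCast]; push_cast; ring
    calc a ^ j * |ρ a - ∑ i ∈ Finset.range (M + 1), ψ i * a ^ i| * |Real.log a| ^ n
        ≤ a ^ j * (|C| * a ^ (M + 1)) * |Real.log a| ^ n := by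
          refine mul_le_mul_of_nonneg_right (mul_le_mul_of_nonneg_left (ha.trans ?_) (zpow_nonneg ha1.1.le _))
            (pow_nonneg (abs_nonneg _) _)
          exact mul_le_mul_of_nonneg_right (le_abs_self C) (pow_nonneg ha1.1.le _)
      _ = |C| * (a ^ ((M : ℤ) + 1 + j) * |Real.log a| ^ n) := by rw [hzp]; ring
  -- assemble
  have htot := hsum.add hrem
  have hval : (∑ i ∈ Finset.range (M + 1), if n = 0 ∧ (i : ℤ) + j = 0 then ψ i else 0) + 0 =
      if n = 0 ∧ j ≤ 0 then ψ (-j).toNat else 0 := by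
    rw [add_zero]
    by_cases hn : n = 0
    · by_cases hj : j ≤ 0
      · rw [if_pos ⟨hn, hj⟩, Finset.sum_eq_single_of_mem M (by simp) (fun i _ hi => if_neg fun h => hi ?_)]
        · rw [if_pos ⟨hn, by rw [hM]; omega⟩]
        · rw [hM]; omega
      · rw [if_neg (fun h => hj h.2)]
        exact Finset.sum_eq_zero fun i _ => if_neg fun h => hj (by omega)
    · rw [if_neg (fun h => hn h.1)]
      exact Finset.sum_eq_zero fun i _ => if_neg fun h => hn h.1
  rw [← hval]
  refine htot.congr ?_
  filter_upwards [self_mem_nhdsWithin] with a ha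
  have ha0 : 0 < a := ha
  have hs : ∑ i ∈ Finset.range (M + 1), ψ i * (a ^ ((i : ℤ) + j) * Real.log a ^ n) =
      a ^ j * (∑ i ∈ Finset.range (M + 1), ψ i * a ^ i) * Real.log a ^ n := by
    rw [Finset.mul_sum, Finset.sum_mul]
    refine Finset.sum_congr rfl fun i _ => ?_
    rw [zpow_add₀ ha0.ne', zpow_natCast]; ring
  show (∑ i ∈ Finset.range (M + 1), ψ i * (a ^ ((i : ℤ) + j) * Real.log a ^ n)) +
      a ^ j * (ρ a - ∑ i ∈ Finset.range (M + 1), ψ i * a ^ i) * Real.log a ^ n = a ^ j * ρ a * Real.log a ^ n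
  rw [hs]; ring

/-- **Taylor expansion of `L_u` at `0⁺` with remainder** (from the power series of
`HyperlogarithmsPowerSeries.lean`, base point `1/2`): `ψ = coeff σ u`. [cite: BrownENS2009, §5.1 eq. (5.3)] -/
theorem hasTaylor_hlog {σ : α → ℝ} (hσ : ∀ c, σ c = 0 ∨ 1 ≤ σ c) {u : List α} (hu : IsReg σ u) :
    HasTaylor (hlog σ u) (coeff σ u) := by
  intro M
  refine ⟨2 ^ (M + 1) * hlog σ u (1 / 2), ?_⟩
  filter_upwards [Ioo_mem_nhdsGT (by norm_num : (0 : ℝ) < 1 / 2)] with a ha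
  obtain ⟨h0, h1⟩ := hlog_sub_sum_le hσ hu M ha.1 ha.2.le (by norm_num)
  rw [abs_of_nonneg h0]
  refine h1.trans (le_of_eq ?_)
  rw [div_pow, show ((1 : ℝ) / 2) ^ (M + 1) = 1 / 2 ^ (M + 1) by rw [div_pow, one_pow]]
  field_simp

/-- Sums of Taylor expansions. [folklore] -/
theorem HasTaylor.add {ρ₁ ρ₂ : ℝ → ℝ} {ψ₁ ψ₂ : ℕ → ℝ} (h₁ : HasTaylor ρ₁ ψ₁) (h₂ : HasTaylor ρ₂ ψ₂) :
    HasTaylor (fun a => ρ₁ a + ρ₂ a) (fun i => ψ₁ i + ψ₂ i) := by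
  intro M
  obtain ⟨C₁, hC₁⟩ := h₁ M
  obtain ⟨C₂, hC₂⟩ := h₂ M
  refine ⟨C₁ + C₂, ?_⟩
  filter_upwards [hC₁, hC₂] with a ha hb
  have heq : ρ₁ a + ρ₂ a - ∑ i ∈ Finset.range (M + 1), (ψ₁ i + ψ₂ i) * a ^ i =
      (ρ₁ a - ∑ i ∈ Finset.range (M + 1), ψ₁ i * a ^ i) + (ρ₂ a - ∑ i ∈ Finset.range (M + 1), ψ₂ i * a ^ i) := by
    simp only [add_mul, Finset.sum_add_distrib]; ring
  rw [heq, add_mul]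
  exact (abs_add_le _ _).trans (add_le_add ha hb)

/-- Scalar multiples of Taylor expansions. [folklore] -/
theorem HasTaylor.smul {ρ : ℝ → ℝ} {ψ : ℕ → ℝ} (h : HasTaylor ρ ψ) (r : ℝ) :
    HasTaylor (fun a => r * ρ a) (fun i => r * ψ i) := by
  intro M
  obtain ⟨C, hC⟩ := h M
  refine ⟨|r| * C, ?_⟩
  filter_upwards [hC] with a ha
  have heq : r * ρ a - ∑ i ∈ Finset.range (M + 1), r * ψ i * a ^ i =
      r * (ρ a - ∑ i ∈ Finset.range (M + 1), ψ i * a ^ i) := by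
    rw [mul_sub, Finset.mul_sum]
    simp only [mul_assoc]
  rw [heq, abs_mul, mul_assoc]
  exact mul_le_mul_of_nonneg_left ha (abs_nonneg r)

/-- The zero function has zero Taylor coefficients. [folklore] -/
theorem hasTaylor_zero : HasTaylor (fun _ => 0) (fun _ => 0) := by
  intro M
  refine ⟨0, Eventually.of_forall fun a => ?_⟩
  simp

/-- Finite sums of Taylor expansions. [folklore] -/
theorem HasTaylor.sum {ι : Type*} (s : Finset ι) {ρ : ι → ℝ → ℝ} {ψ : ι → ℕ → ℝ}
    (h : ∀ i ∈ s, HasTaylor (ρ i) (ψ i)) :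
    HasTaylor (fun a => ∑ i ∈ s, ρ i a) (fun m => ∑ i ∈ s, ψ i m) := by
  classical
  induction s using Finset.induction_on with
  | empty => simpa using hasTaylor_zero
  | insert i s hi IH =>
    have h1 := (h i (Finset.mem_insert_self i s)).add (IH fun j hj => h j (Finset.mem_insert_of_mem hj))
    simp only [Finset.sum_insert hi]
    exact h1

/-- **Taylor expansion of the regularised `f₀(a)_U = Σ_u (regEnd_z U)_u L_u(a)`** at `0⁺`, with
coefficients `φ_{U,m} = Σ_u (regEnd_z U)_u coeff σ u m`. [folklore] -/
theorem hasTaylor_hlogReg [DecidableEq α] {σ : α → ℝ} {z : α} (hz : σ z = 0)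
    (hσz : ∀ c, c ≠ z → 1 ≤ σ c) (U : List α) :
    HasTaylor (hlogReg σ z U) (fun m => Shuffle.pair (fun u => coeff σ u m) (Shuffle.regEnd z U)) := by
  have hσ := adm_of_zero_letter σ hz hσz
  have h := HasTaylor.sum (Shuffle.regEnd z U).support
    (ρ := fun u a => ((Shuffle.regEnd z U) u : ℝ) * hlog σ u a)
    (ψ := fun u m => ((Shuffle.regEnd z U) u : ℝ) * coeff σ u m)
    fun u hu => (hasTaylor_hlog hσ (isReg_of_mem_support_regEnd hz hσz U hu)).smul _
  have hf : hlogReg σ z U = fun a => ∑ u ∈ (Shuffle.regEnd z U).support, ((Shuffle.regEnd z U) u : ℝ) * hlog σ u a := by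
    funext a
    unfold hlogReg Shuffle.pair
    simp only [Finsupp.sum, Rat.smul_def]
  have hc : (fun m => Shuffle.pair (fun u => coeff σ u m) (Shuffle.regEnd z U)) =
      fun m => ∑ u ∈ (Shuffle.regEnd z U).support, ((Shuffle.regEnd z U) u : ℝ) * coeff σ u m := by
    funext m
    unfold Shuffle.pair
    simp only [Finsupp.sum, Rat.smul_def]
  rw [hf, hc]
  exact h

/-- The Taylor coefficients of `f₀(a)_U`. [folklore] -/
def regCoeff [DecidableEq α] (σ : α → ℝ) (z : α) (U : List α) (m : ℕ) : ℝ :=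
  Shuffle.pair (fun u => coeff σ u m) (Shuffle.regEnd z U)

open Finset in
/-- **Regularised value of `a^j ρ(a) L(a)_W` at `0⁺`**: with `ρ` of Taylor coefficients `ψ`,
`Reg_{a=0} a^j ρ(a) L(a)_W = Σ_{i₁+i₂ = -j} ψ_{i₁} φ_{W,i₂}` (the `log⁰` part of `L(a)_W` is
`f₀(a)_W`; all `logⁿ`, `n ≥ 1`, parts and all negative powers are singular, positive powers vanish).
[folklore] -/
theorem hasRegValue_zpow_mul_taylor_mul_hlogSeries [DecidableEq α] {σ : α → ℝ} {z : α} (hz : σ z = 0)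
    (hσz : ∀ c, c ≠ z → 1 ≤ σ c) {ρ : ℝ → ℝ} {ψ : ℕ → ℝ} (hρ : HasTaylor ρ ψ) (j : ℤ) (W : List α) :
    HasRegValue (fun a => a ^ j * ρ a * hlogSeries σ z a W)
      (if j ≤ 0 then ∑ ik ∈ antidiagonal (-j).toNat, ψ ik.1 * regCoeff σ z W ik.2 else 0) := by
  classical
  -- `L(a)_W = Σ_{W = UV} f₀(a)_U E_z(log a)_V`
  have hterm : ∀ p ∈ NCSeries.splits W, HasRegValue
      (fun a => a ^ j * ρ a * (hlogReg σ z p.1 a * Shuffle.expLetter z (Real.log a) p.2))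
      (if p.2 = [] ∧ j ≤ 0 then ∑ ik ∈ antidiagonal (-j).toNat, ψ ik.1 * regCoeff σ z p.1 ik.2 else 0) := by
    intro p _
    by_cases hrep : p.2 = List.replicate p.2.length z
    · -- `E_z(log a)_{zⁿ} = logⁿ a / n!`
      set n := p.2.length with hn
      have hρ' := hρ.mul (hasTaylor_hlogReg hz hσz p.1)
      have hcore := hasRegValue_zpow_mul_taylor_mul_log_pow hρ' j n
      have hcore' := hcore.smul (algebraMap ℚ ℝ (1 / (n.factorial : ℚ)))
      have hval : algebraMap ℚ ℝ (1 / (n.factorial : ℚ)) *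
          (if n = 0 ∧ j ≤ 0 then (fun i => ∑ jk ∈ antidiagonal i, ψ jk.1 *
            Shuffle.pair (fun u => coeff σ u jk.2) (Shuffle.regEnd z p.1)) (-j).toNat else 0) =
          if p.2 = [] ∧ j ≤ 0 then ∑ ik ∈ antidiagonal (-j).toNat, ψ ik.1 * regCoeff σ z p.1 ik.2 else 0 := by
        have hiff : n = 0 ↔ p.2 = [] := by rw [hn, List.length_eq_zero_iff]
        by_cases h0 : p.2 = []
        · have hn0 : n = 0 := hiff.2 h0
          simp only [hn0, h0, true_and, Nat.factorial_zero, Nat.cast_one, div_one, map_one, one_mul]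
          rfl
        · have hn0 : ¬ n = 0 := fun h => h0 (hiff.1 h)
          simp [hn0, h0]
      rw [← hval]
      refine hcore'.congr ?_
      filter_upwards [self_mem_nhdsWithin] with a _
      show algebraMap ℚ ℝ (1 / (n.factorial : ℚ)) * (a ^ j * (ρ a * hlogReg σ z p.1 a) * Real.log a ^ n) =
        a ^ j * ρ a * (hlogReg σ z p.1 a * Shuffle.expLetter z (Real.log a) p.2)
      unfold Shuffle.expLetter
      rw [if_pos hrep]
      ring
    · -- the coefficient of a word with another letter vanishes
      have h0 : ¬ (p.2 = [] ∧ j ≤ 0) := by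
        rintro ⟨h, -⟩; apply hrep; rw [h]; rfl
      rw [if_neg h0]
      refine (hasRegValue_of_tendsto tendsto_const_nhds).congr (Eventually.of_forall fun a => ?_)
      show (0 : ℝ) = a ^ j * ρ a * (hlogReg σ z p.1 a * Shuffle.expLetter z (Real.log a) p.2)
      rw [Shuffle.expLetter_apply_of_ne z _ hrep]; ring
  have hsum := HasRegValue.sum (NCSeries.splits W) hterm
  have hval : (∑ p ∈ NCSeries.splits W,
      if p.2 = [] ∧ j ≤ 0 then ∑ ik ∈ antidiagonal (-j).toNat, ψ ik.1 * regCoeff σ z p.1 ik.2 else 0) =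
      if j ≤ 0 then ∑ ik ∈ antidiagonal (-j).toNat, ψ ik.1 * regCoeff σ z W ik.2 else 0 := by
    rw [Finset.sum_eq_single_of_mem (W, []) (NCSeries.self_nil_mem_splits W)]
    · simp
    · rintro p hp hne
      rw [if_neg]
      rintro ⟨h2, -⟩
      apply hne
      rw [NCSeries.mem_splits] at hp
      ext1
      · simpa [h2] using hp
      · exact h2
  rw [← hval]
  refine hsum.congr (Eventually.of_forall fun a => ?_)
  show ∑ p ∈ NCSeries.splits W, a ^ j * ρ a * (hlogReg σ z p.1 a * Shuffle.expLetter z (Real.log a) p.2) =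
    a ^ j * ρ a * hlogSeries σ z a W
  rw [hlogSeries, NCSeries.mul_apply, Finset.mul_sum]

end RegValues

end Hyperlog

end Literature.NumberTheory.Transcendental
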